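import Summits.PneNP.PneNP.Theorems.ChebyshevTracialDesignVirtualEqualsTight
import HarnessLib

/-!
# Cell pnp-psdrank, route `ChebyshevTracialDesign`: virtual = tight for spread cells in the rung's currency (`A : Finset (OddSet n)`,
# tight pairs counted by `cc U M = 1`) and its two one-sided halves (crux `TracialDecayExp20`, stmt-PneNP-19878)

Brick 175b (prover g34; MEMO-37 §3), a thin wrapper over brick 175 (`…VirtualEqualsTight.value_add_tight_abs_le_of_spread`, stated for families
`X` of `t`-subsets with the tight pairs counted through the partner filter). The cell's rung files (46 `spreadCell_value_le_of_globalLevelD`, 47–50)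
speak of `A : Finset (OddSet n)` and `cc U M = 1`; this file does the conversion once:
* `card_tight_image_eq` — `#{(U,M) ∈ A.image val × Y : #{x ∈ U : π_M x ∉ U} = 1} = #{(U,M) ∈ A × Y : cc U M = 1}`;
* **`value_add_tight_abs_le_of_spread_oddSet`** — for `τ ≥ 1` ∃ `c₀ ∈ (0,1]`, `n₁`: every exact design (`n ≤ 5t`, `D+2 ≤ 2c'`, `D ≤ 2(dq n+8)`,
  `14D ≤ n`), every family `A` of `t`-cuts of density `≥ e^{−c₀dq n}` and every `(PM_n,τ)`-homogeneous `Y` of density `≥ e^{−c₀dq n}`: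
  `|Σ_{U∈A}Σ_{M∈Y} W(U,M) + #{(U,M) ∈ A×Y : cc = 1}/(|PM|·N₁)| ≤ B√(P_Dμν) + 16μν/n + c'√(μν·A_{D/2+1})` — the design value of a spread cell is
  minus its normalised tight mass;
* `value_le_and_ge_neg_tight` — the two halves `V ≤ −Tight + E` (VNS's direction, sharpened) and `−Tight − E ≤ V` (new) from `|V + Tight| ≤ E`.
[cite: Rothvoss2017, §2 (PDF p. 6)] [cite: KeevashLifshitz2023, Thm. 1.8] [cite: KupavskiiZakharov2022, §2] [cite: Grigoriev2001, Lemma 1.4 (PDF p. 8)]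
Stature: support/instrument (kernel lane, no defs, axioms standard; bookkeeping). WHAT THIS IS NOT: nothing beyond brick 175; no proof or refutation
of `TracialDecayExp20`, nothing on psd rank of P_PM(K_n), no P-vs-NP content. Supports stmt-PneNP-19878.
-/

set_option linter.dupNamespace false -- `Summit.PneNP.PneNP.…`: summit = sub-problem (D-0017)

noncomputable section

namespace Summit.PneNP.PneNP.Theorems.ChebyshevTracialDesignVirtualEqualsTightOddSet

open Finset Literature.Barriers.PneNP Literature.Computability.Complexity Literature.Combinatorics.Optimization
open Literature.Combinatorics.AssociationSchemes Literature.Combinatorics.AssociationSchemes.JohnsonHarmonics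
open Literature.Combinatorics.AssociationSchemes.HomogeneousMatchingFamilies
open Literature.Combinatorics.SetFamily
open Literature.Combinatorics.SimpleGraph.CycleSpace
open Summit.PneNP.PneNP.Theorems.ChebyshevTracialDesignTightColumnSums (cc_eq_card_filter_partner)
open Summit.PneNP.PneNP.Theorems.ChebyshevTracialDesignVirtualEqualsTight (value_add_tight_abs_le_of_spread)

variable {n : ℕ}

/-- Tight pairs of `A × Y` counted through `OddSet`/`cc` = tight pairs of `A.image val × Y` counted through the partner filter. -/
theorem card_tight_image_eq (A : Finset (OddSet n)) (Y : Finset (PMatch n)) :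
    (((A.image Subtype.val) ×ˢ Y).filter fun UM : Finset (Fin n) × PMatch n =>
        (UM.1.filter fun x => UM.2.2.partner x ∉ UM.1).card = 1).card =
      ((A ×ˢ Y).filter fun UM : OddSet n × PMatch n => cc UM.1 UM.2 = 1).card := by
  classical
  symm
  refine Finset.card_bij (fun UM _ => (UM.1.1, UM.2)) (fun UM hUM => ?_) (fun a₁ h₁ a₂ h₂ h => ?_) (fun b hb => ?_)
  · obtain ⟨hmem, hcc⟩ := mem_filter.1 hUM
    obtain ⟨hU, hM⟩ := mem_product.1 hmem
    refine mem_filter.2 ⟨mem_product.2 ⟨mem_image_of_mem _ hU, hM⟩, ?_⟩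
    simpa [cc_eq_card_filter_partner] using hcc
  · obtain ⟨h1, h2⟩ := Prod.mk.inj h
    exact Prod.ext (Subtype.ext h1) h2
  · obtain ⟨hmem, hcc⟩ := mem_filter.1 hb
    obtain ⟨hU, hM⟩ := mem_product.1 hmem
    obtain ⟨U', hU', hU'eq⟩ := mem_image.1 hU
    refine ⟨(U', b.2), mem_filter.2 ⟨mem_product.2 ⟨hU', hM⟩, ?_⟩, ?_⟩
    · rw [cc_eq_card_filter_partner, hU'eq]; exact hcc
    · simp [hU'eq]

/-- **VIRTUAL = TIGHT for spread cells, in the rung's currency.** As `value_add_tight_abs_le_of_spread`, for a family `A` of `t`-cuts given as odd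
sets and the tight pairs counted by `cc U M = 1`:
`|Σ_{U∈A} Σ_{M∈Y} W(U,M) + #{(U,M) ∈ A×Y : cc(U,M) = 1}/(|PM|·N₁)| ≤ B·√(P_D μν) + 16μν/n + c'·√(μν·A_{D/2+1})`.
[cite: Rothvoss2017, §2 (PDF p. 6)] [cite: KeevashLifshitz2023, Thm. 1.8] [cite: KupavskiiZakharov2022, §2] -/
theorem value_add_tight_abs_le_of_spread_oddSet {τ : ℝ} (hτ : 1 ≤ τ) :
    ∃ c₀ : ℝ, 0 < c₀ ∧ c₀ ≤ 1 ∧ ∃ n₁ : ℕ, ∀ (n c' T D : ℕ) (Bv : ℝ) (C : Finset ℕ) (w : ℕ → ℝ), n₁ ≤ n → Even n →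
      IsExactDesign n (2 * c' + 1) T D Bv C w → n ≤ 5 * (2 * c' + 1) → D + 2 ≤ 2 * c' → D ≤ 2 * (dq n + 8) → 14 * D ≤ n →
      ∀ (A : Finset (OddSet n)), (∀ U ∈ A, U.1.card = 2 * c' + 1) →
      ∀ (Y : Finset (PMatch n)), IsRelHomogeneous τ (perfectMatchings (univ : Finset (Fin n))) (Y.image Subtype.val) →
      Real.exp (-(c₀ * dq n)) ≤ (A.card : ℝ) / (n.choose (2 * c' + 1) : ℝ) →
      Real.exp (-(c₀ * dq n)) ≤ (Y.card : ℝ) / (Fintype.card (PMatch n) : ℝ) →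
        |∑ U ∈ A, ∑ M ∈ Y, levelWeight n (2 * c' + 1) C w U M +
            ((((A ×ˢ Y).filter fun UM : OddSet n × PMatch n => cc UM.1 UM.2 = 1).card : ℕ) : ℝ) /
              ((Fintype.card (PMatch n) : ℝ) * ((((n / 2).choose (1 + c') * (1 + c').choose c' * 2 ^ 1 : ℕ) : ℝ)))| ≤
          Bv * Real.sqrt ((∏ i ∈ range (D / 2 + 1), ((2 * i + 1 : ℝ) / ((n : ℝ) - 2 * i))) *
              ((A.card : ℝ) / (n.choose (2 * c' + 1) : ℝ)) * ((Y.card : ℝ) / (Fintype.card (PMatch n) : ℝ))) +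
            16 * (((A.card : ℝ) / (n.choose (2 * c' + 1) : ℝ)) * ((Y.card : ℝ) / (Fintype.card (PMatch n) : ℝ))) / n +
            (c' : ℝ) * Real.sqrt (((A.card : ℝ) / (n.choose (2 * c' + 1) : ℝ)) *
              ((Y.card : ℝ) / (Fintype.card (PMatch n) : ℝ)) * ∏ i ∈ range (D / 2 + 1), ((2 * i + 1 : ℝ) / ((n : ℝ) - 2 * i))) := by
  classical
  obtain ⟨c₀, hc₀, hc₀1, n₁, h⟩ := value_add_tight_abs_le_of_spread hτ
  refine ⟨c₀, hc₀, hc₀1, n₁, ?_⟩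
  intro n c' T D Bv C w hn₁ hn hdes hbal hD2 hDq hDn A hA Y hhom hμ hν
  set X : Finset (Finset (Fin n)) := A.image Subtype.val with hXdef
  have hX : X ⊆ univ.powersetCard (2 * c' + 1) := by
    intro U hU
    obtain ⟨U', hU', rfl⟩ := mem_image.1 hU
    exact mem_powersetCard_univ.2 (hA U' hU')
  have hcard : (X.card : ℝ) = A.card := by rw [hXdef, card_image_of_injective _ Subtype.val_injective]
  have hμ' : Real.exp (-(c₀ * dq n)) ≤ (X.card : ℝ) / (n.choose (2 * c' + 1) : ℝ) := by rw [hcard]; exact hμ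
  have key := h n c' T D Bv C w hn₁ hn hdes hbal hD2 hDq hDn X hX Y hhom hμ' hν
  -- the indicator-weighted sum is the sum over `A`
  have hsum : ∑ U : OddSet n, ∑ M ∈ Y, levelWeight n (2 * c' + 1) C w U M * (if U.1 ∈ X then (1 : ℝ) else 0) =
      ∑ U ∈ A, ∑ M ∈ Y, levelWeight n (2 * c' + 1) C w U M := by
    have hmem : ∀ U : OddSet n, U.1 ∈ X ↔ U ∈ A := by
      intro U
      rw [hXdef, mem_image]
      constructor
      · rintro ⟨U', hU', h⟩; rwa [← Subtype.ext h]
      · intro hU; exact ⟨U, hU, rfl⟩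
    rw [← sum_filter_add_sum_filter_not univ (fun U : OddSet n => U ∈ A)]
    have h0 : ∑ U ∈ univ.filter (fun U : OddSet n => ¬U ∈ A), ∑ M ∈ Y,
        levelWeight n (2 * c' + 1) C w U M * (if U.1 ∈ X then (1 : ℝ) else 0) = 0 :=
      sum_eq_zero fun U hU => by
        have : ¬U.1 ∈ X := fun h => (mem_filter.1 hU).2 ((hmem U).1 h)
        simp [this]
    rw [h0, add_zero, show univ.filter (fun U : OddSet n => U ∈ A) = A by ext U; simp]
    refine sum_congr rfl fun U hU => sum_congr rfl fun M _ => ?_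
    rw [if_pos ((hmem U).2 hU), mul_one]
  rw [hsum, hcard, hXdef, card_tight_image_eq A Y] at key
  exact key

/-- **The two halves, named.** Upper (VNS's direction, sharpened by the tight mass): `V(A×Y) ≤ −Tight(A×Y) + B√(P_Dμν) + 16μν/n + c'√(μνA)`;
lower (new): `V(A×Y) ≥ −Tight(A×Y) − (B√(P_Dμν) + 16μν/n + c'√(μνA))`. Immediate from the absolute-value form (`abs_le`); stated for
consumers that want one direction. [cite: Rothvoss2017, §2 (PDF p. 6)] [cite: KeevashLifshitz2023, Thm. 1.8] -/
theorem value_le_and_ge_neg_tight {V Tt E : ℝ} (h : |V + Tt| ≤ E) : V ≤ -Tt + E ∧ -Tt - E ≤ V := by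
  obtain ⟨h1, h2⟩ := abs_le.1 h
  exact ⟨by linarith, by linarith⟩

end Summit.PneNP.PneNP.Theorems.ChebyshevTracialDesignVirtualEqualsTightOddSet
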